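/-
VALUE = THEOREM (an engine for configuration exclusions), NOT summit progress (cell b2b-lgcu-borel,
gen 23); the crux item stmt-MatrixMultiplication-14079 is untouched and remains open.
-/
import Mathlib
import Summits.MatrixMultiplication.MatrixMultiplication.Theorems.SubgroupIdentityDesigns.Negative.VectorTransportSpan
import Summits.MatrixMultiplication.MatrixMultiplication.Theorems.SubgroupIdentityDesigns.Negative.PackingBridge
import Summits.MatrixMultiplication.MatrixMultiplication.Theorems.SubgroupIdentityDesigns.Negative.GLmLevelOneCertificates

/-!
# The permutation certificate: an elementary matrix-coefficient obstruction to level-one designs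

VALUE = THEOREM (an engine), NOT summit progress; the crux item stmt-MatrixMultiplication-14079 is
untouched and remains open.

THE CRITERION (`no_design_of_permCert`).  Let `KS ⊆ GL_m(𝔽_p)` be a finite set containing `1` and
closed under products and inverses (a subgroup given as data), let `act` be an action of `GL_m(𝔽_p)`
on a finite type `Ω` (`act (ab) = act a ∘ act b`, `act 1 = id`), and let `w : Ω → ℤ` be a non-zero
weight whose STABILISER ORBIT SUMS VANISH:
  `∀ x ≠ 0, ∀ ω,  Σ_{s ∈ KS, s x = x} w(act s ω) = 0`.
If every `k ∈ KS ∖ 1` is a triple product `a b g` (`a ∈ H₁`, `b ∈ H₂`, `g ∈ H₃`), then `(H₁,H₂,H₃)`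
carries no level-one identity design (the design clause of the crux at level `k = 1`, negated).
`no_design_of_permCert_subgroup` is the same for a `Subgroup`; `cover_of_subset₁/₂/₃` give the
single-member placements `KS ⊆ Hᵢ`.

PROOF.  The matrix coefficient `c(k) = Σ_ω w(act k ω)·w(ω)` (`coeff`) has vanishing VECTOR-TRANSPORT
SUMS `Σ_{k ∈ KS, k u = a} c(k) = 0` for all `u, a` (`coeff_transport`): for `u ≠ 0` the fibre
`{k : k u = a}` is the coset `S_a k₀` of the stabiliser of `a = k₀ u ≠ 0` and
`Σ_{s ∈ S_a} w(act s (act k₀ ω)) = 0` (`fibre_sum_eq_zero`); for `u = 0 = a` partition `KS` by the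
image of a fixed non-zero vector.  Hence `Λ(h) = Σ_{k ∈ KS} c(k) h(k)` (`Lam`) kills every transport
indicator `g ↦ [g u = a]` and so the whole level-one space
(`VectorTransportSpan.levelSubmodule_le_of_transport`; `levelSubmodule_le_ker`), while on the test
function `f` of a design (`PackingBridge.exists_test`: `f(1) = 1`, `f = 0` on `KS ∖ 1` by the cover)
`Λ(f) = c(1) = Σ_ω w(ω)² > 0`.

WHY IT IS THE RIGHT ENGINE.  `c` is a matrix coefficient of the permutation module `ℤ[Ω]`, and the
orbit-sum hypothesis says that `w` is orthogonal to the fixed vectors of every vector stabiliser `S_x`,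
i.e. `w` lies in the part of `ℚ[Ω]` carried by irreducibles of `K` that do not occur in the level-one
space `F₁|_K = Σ_x 1↑_{S_x}`.  So `c` replaces the "missing cusp form" of `CuspidalObstruction` by a
statement with no character table and no Frobenius reciprocity, DECIDABLE at fixed `p`: the companion
file `SignedOrthogonalFive` evaluates it (`native_decide`) for the order-120 class
`⟨non-square reflections⟩ < GL₃(𝔽₅)`, the one minimal `(3,5)` class not reached by fixed vectors,
`det`-characters or sign characters.

HONEST SCOPE.  An engine; it empties no `(p,m,ε)` cell by itself.
-/

set_option linter.dupNamespace false

noncomputable section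

open scoped BigOperators Matrix

namespace Summit.MatrixMultiplication.MatrixMultiplication.Theorems.SubgroupIdentityDesigns.Negative
namespace PermutationCertificate

open Summit.MatrixMultiplication.MatrixMultiplication.Theorems.LieRankDesigns.Negative (GLm Mat)
open Summit.MatrixMultiplication.MatrixMultiplication.Theorems.LevelOneGL2Designs.Negative
  (levelSubmodule)
open PackingBridge (exists_test)
open VectorTransportSpan (levelSubmodule_le_of_transport)

variable {p : ℕ} [hp : Fact p.Prime] {m : ℕ} {Ω : Type*} [Fintype Ω]

/-! ## The matrix coefficient and its transport sums -/

/-- The matrix coefficient `c_w(k) = Σ_ω w(act k ω) · w(ω)` of the weight `w`. -/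
def coeff (act : GLm p m → Ω → Ω) (w : Ω → ℤ) (k : GLm p m) : ℤ :=
  ∑ ω, w (act k ω) * w ω

omit hp in
/-- `c_w(1) = Σ_ω w(ω)²` when `act 1 = id`. -/
theorem coeff_one {act : GLm p m → Ω → Ω} (hact1 : ∀ ω, act 1 ω = ω) (w : Ω → ℤ) :
    coeff act w 1 = ∑ ω, w ω * w ω :=
  Finset.sum_congr rfl fun ω _ => by rw [hact1]

section transport

variable (KS : Finset (GLm p m)) (hmul : ∀ a ∈ KS, ∀ b ∈ KS, a * b ∈ KS)
  (hinv : ∀ a ∈ KS, a⁻¹ ∈ KS) (act : GLm p m → Ω → Ω)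
  (hact : ∀ a b ω, act (a * b) ω = act a (act b ω)) (w : Ω → ℤ)
  (horb : ∀ x : Fin m → ZMod p, x ≠ 0 → ∀ ω,
    (∑ s ∈ KS.filter (fun s : GLm p m => (s : Mat p m) *ᵥ x = x), w (act s ω)) = 0)
include hmul hinv hact horb

omit [Fintype Ω] in
/-- Orbit sums over a fibre `{k ∈ KS : k u = a}`, `u ≠ 0`, vanish: the fibre is empty or the coset
`S_a · k₀` of the stabiliser of `a = k₀ u ≠ 0`. -/
theorem fibre_sum_eq_zero {u : Fin m → ZMod p} (hu : u ≠ 0) (a : Fin m → ZMod p) (ω : Ω) :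
    (∑ k ∈ KS.filter (fun k : GLm p m => (k : Mat p m) *ᵥ u = a), w (act k ω)) = 0 := by
  by_cases hex : ∃ k₀ ∈ KS, ((k₀ : GLm p m) : Mat p m) *ᵥ u = a
  · obtain ⟨k₀, hk₀, hk₀u⟩ := hex
    have ha : a ≠ 0 := hk₀u ▸ glm_mulVec_ne_zero k₀ hu
    rw [← horb a ha (act k₀ ω)]
    symm
    refine Finset.sum_bij' (fun s _ => s * k₀) (fun k _ => k * k₀⁻¹) ?_ ?_ ?_ ?_ ?_
    · intro s hs
      rw [Finset.mem_filter] at hs ⊢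
      exact ⟨hmul _ hs.1 _ hk₀, by rw [Units.val_mul, ← Matrix.mulVec_mulVec, hk₀u, hs.2]⟩
    · intro k hk
      rw [Finset.mem_filter] at hk ⊢
      refine ⟨hmul _ hk.1 _ (hinv _ hk₀), ?_⟩
      have hk₀a : ((k₀⁻¹ : GLm p m) : Mat p m) *ᵥ a = u := by
        rw [← hk₀u, Matrix.mulVec_mulVec, ← Units.val_mul, inv_mul_cancel, Units.val_one,
          Matrix.one_mulVec]
      rw [Units.val_mul, ← Matrix.mulVec_mulVec, hk₀a, hk.2]
    · intro s _; exact mul_inv_cancel_right s k₀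
    · intro k _; exact inv_mul_cancel_right k k₀
    · intro s _; rw [hact]
  · rw [Finset.filter_eq_empty_iff.mpr fun k hk h => hex ⟨k, hk, h⟩, Finset.sum_empty]

omit [Fintype Ω] in
/-- Orbit sums over every fibre `{k ∈ KS : k u = a}` vanish (`u = 0 = a`: partition `KS` by the image
of a fixed non-zero vector). -/
theorem fibre_sum_eq_zero' [NeZero m] (u a : Fin m → ZMod p) (ω : Ω) :
    (∑ k ∈ KS.filter (fun k : GLm p m => (k : Mat p m) *ᵥ u = a), w (act k ω)) = 0 := by
  by_cases hu : u = 0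
  · subst hu
    by_cases ha : a = 0
    · subst ha
      have hfilt : KS.filter (fun k => ((k : GLm p m) : Mat p m) *ᵥ (0 : Fin m → ZMod p) = 0) = KS :=
        Finset.filter_true_of_mem fun k _ => Matrix.mulVec_zero _
      rw [hfilt]
      have hx₀ : (Pi.single 0 1 : Fin m → ZMod p) ≠ 0 := by
        intro h
        have h0 := congr_fun h 0
        rw [Pi.single_eq_same, Pi.zero_apply] at h0
        exact one_ne_zero h0
      rw [← Finset.sum_fiberwise KS (fun k => ((k : GLm p m) : Mat p m) *ᵥ (Pi.single 0 1))
        (fun k => w (act k ω))]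
      exact Finset.sum_eq_zero fun a _ => fibre_sum_eq_zero KS hmul hinv act hact w horb hx₀ a ω
    · have hfilt : KS.filter (fun k => ((k : GLm p m) : Mat p m) *ᵥ (0 : Fin m → ZMod p) = a) = ∅ :=
        Finset.filter_eq_empty_iff.mpr fun k _ h => ha (by rw [← h, Matrix.mulVec_zero])
      rw [hfilt, Finset.sum_empty]
  · exact fibre_sum_eq_zero KS hmul hinv act hact w horb hu a ω

/-- **TRANSPORT SUMS OF THE MATRIX COEFFICIENT VANISH**: `Σ_{k ∈ KS, k u = a} c_w(k) = 0`. -/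
theorem coeff_transport [NeZero m] (u a : Fin m → ZMod p) :
    (∑ k ∈ KS.filter (fun k : GLm p m => (k : Mat p m) *ᵥ u = a), coeff act w k) = 0 := by
  simp only [coeff]
  rw [Finset.sum_comm]
  refine Finset.sum_eq_zero fun ω _ => ?_
  rw [← Finset.sum_mul, fibre_sum_eq_zero' KS hmul hinv act hact w horb u a ω, zero_mul]

end transport

/-! ## The functional `Λ` and the exclusion -/

/-- `Λ(h) = Σ_{k ∈ KS} c_w(k) h(k)` on functions `GL_m(𝔽_p) → ℂ`. -/
def Lam (KS : Finset (GLm p m)) (act : GLm p m → Ω → Ω) (w : Ω → ℤ) : (GLm p m → ℂ) →ₗ[ℂ] ℂ where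
  toFun h := ∑ k ∈ KS, (coeff act w k : ℂ) * h k
  map_add' h h' := by simp only [Pi.add_apply, mul_add, Finset.sum_add_distrib]
  map_smul' r h := by
    simp only [RingHom.id_apply, smul_eq_mul, Finset.mul_sum]
    exact Finset.sum_congr rfl fun s _ => by rw [Pi.smul_apply, smul_eq_mul]; ring

omit hp in
/-- Unfolding `Λ`. -/
theorem Lam_apply (KS : Finset (GLm p m)) (act : GLm p m → Ω → Ω) (w : Ω → ℤ) (h : GLm p m → ℂ) :
    Lam KS act w h = ∑ k ∈ KS, (coeff act w k : ℂ) * h k := rfl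

/-- **`Λ` VANISHES ON THE LEVEL-ONE SPACE.** -/
theorem levelSubmodule_le_ker [NeZero m] (KS : Finset (GLm p m))
    (hmul : ∀ a ∈ KS, ∀ b ∈ KS, a * b ∈ KS) (hinv : ∀ a ∈ KS, a⁻¹ ∈ KS) (act : GLm p m → Ω → Ω)
    (hact : ∀ a b ω, act (a * b) ω = act a (act b ω)) (w : Ω → ℤ)
    (horb : ∀ x : Fin m → ZMod p, x ≠ 0 → ∀ ω,
      (∑ s ∈ KS.filter (fun s : GLm p m => (s : Mat p m) *ᵥ x = x), w (act s ω)) = 0) :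
    levelSubmodule p m 1 ≤ LinearMap.ker (Lam KS act w) :=
  levelSubmodule_le_of_transport fun u a => by
    rw [LinearMap.mem_ker, Lam_apply]
    simp only [mul_ite, mul_one, mul_zero]
    rw [← Finset.sum_filter]
    exact_mod_cast coeff_transport KS hmul hinv act hact w horb u a

/-- **THE PERMUTATION CERTIFICATE.**  A subgroup `KS ≤ GL_m(𝔽_p)` given as a finite set, an action on
a finite type and a non-zero integer weight with vanishing stabiliser orbit sums: if `KS ∖ 1` is
covered by the triple products `H₁ H₂ H₃`, then `(H₁,H₂,H₃)` carries no level-one identity design. -/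
theorem no_design_of_permCert [NeZero m] {H₁ H₂ H₃ : Subgroup (GLm p m)} (KS : Finset (GLm p m))
    (h1 : (1 : GLm p m) ∈ KS) (hmul : ∀ a ∈ KS, ∀ b ∈ KS, a * b ∈ KS) (hinv : ∀ a ∈ KS, a⁻¹ ∈ KS)
    (act : GLm p m → Ω → Ω) (hact : ∀ a b ω, act (a * b) ω = act a (act b ω))
    (hact1 : ∀ ω, act 1 ω = ω) (w : Ω → ℤ) (hw : ∃ ω, w ω ≠ 0)
    (horb : ∀ x : Fin m → ZMod p, x ≠ 0 → ∀ ω,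
      (∑ s ∈ KS.filter (fun s : GLm p m => (s : Mat p m) *ᵥ x = x), w (act s ω)) = 0)
    (hcov : ∀ k ∈ KS, k ≠ 1 → ∃ a ∈ H₁, ∃ b ∈ H₂, ∃ g ∈ H₃, a * b * g = k) :
    ¬ ∃ c : Mat p m → ℂ, (∀ M, 1 < M.rank → c M = 0) ∧
      (∑ M, c M * ZMod.stdAddChar (Matrix.trace (M * ((1 : GLm p m) : Mat p m)))) = 1 ∧
      ∀ a ∈ H₁, ∀ b ∈ H₂, ∀ g ∈ H₃, a * b * g ≠ 1 →
        (∑ M, c M * ZMod.stdAddChar (Matrix.trace (M * ((a * b * g : GLm p m) : Mat p m)))) = 0 := by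
  intro hdes
  obtain ⟨f, hf, hf1, hf0⟩ := exists_test hdes
  have hz : Lam KS act w f = 0 :=
    LinearMap.mem_ker.mp (levelSubmodule_le_ker KS hmul hinv act hact w horb hf)
  have hval : Lam KS act w f = (coeff act w 1 : ℂ) := by
    rw [Lam_apply, Finset.sum_eq_single_of_mem (1 : GLm p m) h1]
    · rw [hf1, mul_one]
    · intro k hk hk1
      obtain ⟨a, ha, b, hb, g, hg, habg⟩ := hcov k hk hk1
      have hne : a * b * g ≠ 1 := by rw [habg]; exact hk1
      rw [← habg, hf0 a ha b hb g hg hne, mul_zero]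
  rw [hval, coeff_one hact1] at hz
  have hsum : ∑ ω, w ω * w ω = 0 := by exact_mod_cast hz
  obtain ⟨ω₀, hω₀⟩ := hw
  have hle : w ω₀ * w ω₀ ≤ ∑ ω, w ω * w ω :=
    Finset.single_le_sum (fun ω _ => mul_self_nonneg (w ω)) (Finset.mem_univ ω₀)
  rw [hsum] at hle
  exact hω₀ (mul_self_eq_zero.mp (le_antisymm hle (mul_self_nonneg _)))

/-- The same criterion for a `Subgroup K`, the stabiliser sums written over
`{s ∈ GL_m(𝔽_p) : s ∈ K ∧ s x = x}`. -/
theorem no_design_of_permCert_subgroup [NeZero m] {H₁ H₂ H₃ : Subgroup (GLm p m)}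
    (K : Subgroup (GLm p m)) [DecidablePred (· ∈ K)]
    (act : GLm p m → Ω → Ω) (hact : ∀ a b ω, act (a * b) ω = act a (act b ω))
    (hact1 : ∀ ω, act 1 ω = ω) (w : Ω → ℤ) (hw : ∃ ω, w ω ≠ 0)
    (horb : ∀ x : Fin m → ZMod p, x ≠ 0 → ∀ ω,
      (∑ s ∈ Finset.univ.filter (fun s : GLm p m => s ∈ K ∧ (s : Mat p m) *ᵥ x = x),
        w (act s ω)) = 0)
    (hcov : ∀ k ∈ K, k ≠ 1 → ∃ a ∈ H₁, ∃ b ∈ H₂, ∃ g ∈ H₃, a * b * g = k) :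
    ¬ ∃ c : Mat p m → ℂ, (∀ M, 1 < M.rank → c M = 0) ∧
      (∑ M, c M * ZMod.stdAddChar (Matrix.trace (M * ((1 : GLm p m) : Mat p m)))) = 1 ∧
      ∀ a ∈ H₁, ∀ b ∈ H₂, ∀ g ∈ H₃, a * b * g ≠ 1 →
        (∑ M, c M * ZMod.stdAddChar (Matrix.trace (M * ((a * b * g : GLm p m) : Mat p m)))) = 0 :=
  no_design_of_permCert (Finset.univ.filter (· ∈ K)) (by simp [K.one_mem])
    (fun a ha b hb => by
      simp only [Finset.mem_filter, Finset.mem_univ, true_and] at ha hb ⊢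
      exact K.mul_mem ha hb)
    (fun a ha => by
      simp only [Finset.mem_filter, Finset.mem_univ, true_and] at ha ⊢
      exact K.inv_mem ha)
    act hact hact1 w hw
    (fun x hx ω => by rw [Finset.filter_filter]; exact horb x hx ω)
    (fun k hk => hcov k (by simpa using hk))

/-! ## Single-member placements -/

omit hp in
/-- `KS ⊆ H₁` ⇒ every `k ∈ KS` is the triple product `k · 1 · 1`. -/
theorem cover_of_subset₁ {H₁ H₂ H₃ : Subgroup (GLm p m)} {KS : Finset (GLm p m)}
    (hKH : ∀ k ∈ KS, k ∈ H₁) :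
    ∀ k ∈ KS, k ≠ 1 → ∃ a ∈ H₁, ∃ b ∈ H₂, ∃ g ∈ H₃, a * b * g = k :=
  fun k hk _ => ⟨k, hKH k hk, 1, H₂.one_mem, 1, H₃.one_mem, by rw [mul_one, mul_one]⟩

omit hp in
/-- `KS ⊆ H₂` ⇒ every `k ∈ KS` is the triple product `1 · k · 1`. -/
theorem cover_of_subset₂ {H₁ H₂ H₃ : Subgroup (GLm p m)} {KS : Finset (GLm p m)}
    (hKH : ∀ k ∈ KS, k ∈ H₂) :
    ∀ k ∈ KS, k ≠ 1 → ∃ a ∈ H₁, ∃ b ∈ H₂, ∃ g ∈ H₃, a * b * g = k :=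
  fun k hk _ => ⟨1, H₁.one_mem, k, hKH k hk, 1, H₃.one_mem, by rw [one_mul, mul_one]⟩

omit hp in
/-- `KS ⊆ H₃` ⇒ every `k ∈ KS` is the triple product `1 · 1 · k`. -/
theorem cover_of_subset₃ {H₁ H₂ H₃ : Subgroup (GLm p m)} {KS : Finset (GLm p m)}
    (hKH : ∀ k ∈ KS, k ∈ H₃) :
    ∀ k ∈ KS, k ≠ 1 → ∃ a ∈ H₁, ∃ b ∈ H₂, ∃ g ∈ H₃, a * b * g = k :=
  fun k hk _ => ⟨1, H₁.one_mem, 1, H₂.one_mem, k, hKH k hk, by rw [one_mul, one_mul]⟩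

end PermutationCertificate
end Summit.MatrixMultiplication.MatrixMultiplication.Theorems.SubgroupIdentityDesigns.Negative
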